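import Summits.ValiantsHypothesis.ValiantsHypothesis.Theorems.LacunarySymmetroidMatrixDescartesDoorA26WallBubblingClassMoments

/-!
# Wall bubbling for `DoorA26` — (W) chain piece: LEVEL SELECTION (one merging class, given the cluster scale)

HONEST FRAMING.  Chain lemma for obligation (W) `stub_weylFaces` of `Cruxes/DoorA26/Lines/wall_bubbling.lean` (stmt-ValiantsHypothesis-19979
`DoorA26`; OPEN, typed, never asserted), re-pointed seat val-sym-door-p1 g13 (W2 #10).  Produces the hypotheses of W2 #8 `classTower_limit` for ONE
merging value class from bounded data: a gap scale `0 < w_ν → 0`, member deviations `ε_i^ν`, coefficients `a_i^ν`, a cluster scale `μ_ν > 0` that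
DOMINATES the class moments (`|M_m^ν| ≤ μ_ν` for `m < n`, `M_m^ν = Σ_i a_i^ν (ε_i^ν)^m` — true when `μ_ν` is the maximum of all normalised moments of
the cluster), and VANDERMONDE CONTROL of the coefficients by the moments (`|a_i^ν|·w_ν^{n−1} ≤ K·Σ_{m<n} |M_m^ν|` — supplied per configuration by
W2 #6 `moments_two_inv` / `moments_three_inv` at a generic Weyl face).  THEN along a subsequence the normalised moments converge and the tail
`(Σ_i |a_i^ν|)·w_ν^n/μ_ν → 0` (`levelSelection_class`).  If moreover the scale is ATTAINED in the class infinitely often (`|M_m^ν| = μ_ν` for some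
`m < n`), some limit moment has modulus `1` (`levelSelection_class_nondeg`) — the non-degeneracy that makes the limit slot vector non-zero.
No new definitions; nothing here bears on `DoorA26`, `MatrixDescartes` (stmt-ValiantsHypothesis-18050) or `VP ≠ VNP`.

[folklore] Bolzano–Weierstrass; elementary estimates.
-/

-- `Summit.ValiantsHypothesis.ValiantsHypothesis.…` repeats a component by the D-0017 layout
-- (single-conjunct summit), which the `dupNamespace` linter flags; the name is mandated.
set_option linter.dupNamespace false

namespace Summit.ValiantsHypothesis.ValiantsHypothesis.Theorems.LacunarySymmetroidMatrixDescartes.WallBubbling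

open Finset Filter Topology
open scoped BigOperators

/-- **LEVEL SELECTION (one class, given the scale).**  See the module docstring. [folklore] -/
theorem levelSelection_class {ι : Type*} [Fintype ι] (n : ℕ) (a ε : ℕ → ι → ℝ) (w μ : ℕ → ℝ) (K : ℝ)
    (hμ : ∀ ν, 0 < μ ν) (hw0 : ∀ ν, 0 < w ν) (hwlim : Tendsto w atTop (𝓝 0))
    (hdom : ∀ ν, ∀ m < n, |∑ i, a ν i * ε ν i ^ m| ≤ μ ν)
    (hV : ∀ ν i, |a ν i| * w ν ^ (n - 1) ≤ K * ∑ m ∈ Finset.range n, |∑ i', a ν i' * ε ν i' ^ m|) :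
    ∃ φ : ℕ → ℕ, StrictMono φ ∧ ∃ c : ℕ → ℝ,
      (∀ m < n, Tendsto (fun k => (∑ i, a (φ k) i * ε (φ k) i ^ m) / μ (φ k)) atTop (𝓝 (c m))) ∧
      (∀ m < n, |c m| ≤ 1) ∧
      Tendsto (fun k => (∑ i, |a (φ k) i|) * w (φ k) ^ n / μ (φ k)) atTop (𝓝 0) := by
  classical
  -- the normalised moment vectors live in the compact cube `[-1,1]^n`
  set v : ℕ → Fin n → ℝ := fun ν m => (∑ i, a ν i * ε ν i ^ (m : ℕ)) / μ ν with hv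
  have hvmem : ∀ ν, v ν ∈ Set.Icc (fun _ : Fin n => (-1 : ℝ)) (fun _ => 1) := by
    intro ν
    have hab : ∀ m : Fin n, |v ν m| ≤ 1 := by
      intro m
      simp only [hv]
      rw [abs_div, abs_of_pos (hμ ν), div_le_one (hμ ν)]
      exact hdom ν m m.isLt
    exact ⟨fun m => (abs_le.mp (hab m)).1, fun m => (abs_le.mp (hab m)).2⟩
  obtain ⟨cv, -, φ, hφ, hlim⟩ := (isCompact_Icc (a := fun _ : Fin n => (-1 : ℝ)) (b := fun _ => 1)).tendsto_subseq hvmem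
  have hlim_m : ∀ m : Fin n, Tendsto (fun k => v (φ k) m) atTop (𝓝 (cv m)) := fun m => tendsto_pi_nhds.mp hlim m
  refine ⟨φ, hφ, fun m => if h : m < n then cv ⟨m, h⟩ else 0, ?_, ?_, ?_⟩
  · intro m hm
    simp only [dif_pos hm]
    exact (hlim_m ⟨m, hm⟩).congr fun k => by simp [hv]
  · intro m hm
    simp only [dif_pos hm]
    have h1 : ∀ k, |v (φ k) ⟨m, hm⟩| ≤ 1 := fun k => abs_le.mpr ⟨(hvmem (φ k)).1 ⟨m, hm⟩, (hvmem (φ k)).2 ⟨m, hm⟩⟩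
    exact le_of_tendsto ((continuous_abs.tendsto _).comp (hlim_m ⟨m, hm⟩)) (Eventually.of_forall h1)
  · -- the tail: `Σ|a_i| w^n / μ ≤ |ι| K n · w → 0`
    have hφt : Tendsto φ atTop atTop := hφ.tendsto_atTop
    have hbound : ∀ k, |(∑ i, |a (φ k) i|) * w (φ k) ^ n / μ (φ k)| ≤ (Fintype.card ι : ℝ) * (|K| * n) * w (φ k) := by
      intro k
      set ν := φ k
      have hμν := hμ ν
      have hwν := hw0 ν
      rcases Nat.eq_zero_or_pos n with hn | hn
      · -- `n = 0`: the Vandermonde hypothesis forces `a = 0`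
        subst hn
        have ha : ∀ i, a ν i = 0 := by
          intro i
          have h := hV ν i
          simp only [Nat.zero_sub, pow_zero, mul_one, Finset.range_zero, Finset.sum_empty, mul_zero] at h
          exact abs_eq_zero.mp (le_antisymm h (abs_nonneg _))
        simp [ha]
      · have hsum : (∑ i, |a ν i|) * w ν ^ n ≤ (Fintype.card ι : ℝ) * (|K| * n) * w ν * μ ν := by
          have hi : ∀ i, |a ν i| * w ν ^ n ≤ (|K| * n) * w ν * μ ν := by
            intro i
            have h1 : |a ν i| * w ν ^ (n - 1) ≤ K * ∑ m ∈ Finset.range n, |∑ i', a ν i' * ε ν i' ^ m| := hV ν i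
            have h2 : ∑ m ∈ Finset.range n, |∑ i', a ν i' * ε ν i' ^ m| ≤ n * μ ν := by
              calc ∑ m ∈ Finset.range n, |∑ i', a ν i' * ε ν i' ^ m| ≤ ∑ m ∈ Finset.range n, μ ν :=
                    Finset.sum_le_sum fun m hm => hdom ν m (Finset.mem_range.mp hm)
                _ = n * μ ν := by simp
            have hS0 : 0 ≤ ∑ m ∈ Finset.range n, |∑ i', a ν i' * ε ν i' ^ m| := Finset.sum_nonneg fun _ _ => abs_nonneg _
            have h3 : K * ∑ m ∈ Finset.range n, |∑ i', a ν i' * ε ν i' ^ m| ≤ |K| * (n * μ ν) :=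
              le_trans (mul_le_mul_of_nonneg_right (le_abs_self K) hS0) (mul_le_mul_of_nonneg_left h2 (abs_nonneg K))
            have hpow : w ν ^ n = w ν ^ (n - 1) * w ν := by
              rw [← pow_succ, Nat.sub_add_cancel hn]
            calc |a ν i| * w ν ^ n = (|a ν i| * w ν ^ (n - 1)) * w ν := by rw [hpow, mul_assoc]
              _ ≤ (|K| * (n * μ ν)) * w ν := mul_le_mul_of_nonneg_right (h1.trans h3) hwν.le
              _ = (|K| * n) * w ν * μ ν := by ring
          calc (∑ i, |a ν i|) * w ν ^ n = ∑ i, |a ν i| * w ν ^ n := by rw [Finset.sum_mul]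
            _ ≤ ∑ _i : ι, (|K| * n) * w ν * μ ν := Finset.sum_le_sum fun i _ => hi i
            _ = (Fintype.card ι : ℝ) * (|K| * n) * w ν * μ ν := by
                rw [Finset.sum_const, Finset.card_univ, nsmul_eq_mul]; ring
        rw [abs_div, abs_of_pos hμν, div_le_iff₀ hμν,
          abs_of_nonneg (mul_nonneg (Finset.sum_nonneg fun _ _ => abs_nonneg _) (pow_nonneg hwν.le _))]
        exact hsum
    have hlim0 : Tendsto (fun k => (Fintype.card ι : ℝ) * (|K| * n) * w (φ k)) atTop (𝓝 0) := by
      simpa using (hwlim.comp hφt).const_mul ((Fintype.card ι : ℝ) * (|K| * n))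
    exact squeeze_zero_norm' (Eventually.of_forall hbound) hlim0

/-- **Non-degeneracy.**  If the scale is attained in the class infinitely often along the selected subsequence, some limit moment has modulus
`1`. [folklore] -/
theorem levelSelection_class_nondeg (n : ℕ) (Mn : ℕ → ℕ → ℝ) (μ : ℕ → ℝ) (c : ℕ → ℝ)
    (hconv : ∀ m < n, Tendsto (fun k => Mn k m / μ k) atTop (𝓝 (c m)))
    (hatt : ∀ k, ∃ m < n, |Mn k m| = μ k) (hμ : ∀ k, 0 < μ k) : ∃ m < n, |c m| = 1 := by
  classical
  -- some `m < n` attains the scale for infinitely many `k`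
  by_contra hne
  push Not at hne
  have hfin : ∀ m < n, ∀ᶠ k in atTop, |Mn k m| ≠ μ k := by
    intro m hm
    have h1 : Tendsto (fun k => |Mn k m / μ k|) atTop (𝓝 |c m|) := (continuous_abs.tendsto _).comp (hconv m hm)
    have hne1 : |c m| ≠ 1 := hne m hm
    have : ∀ᶠ k in atTop, |Mn k m / μ k| ≠ 1 := h1.eventually (isOpen_ne.mem_nhds hne1)
    refine this.mono fun k hk habs => hk ?_
    rw [abs_div, abs_of_pos (hμ k), habs, div_self (hμ k).ne']
  have hall : ∀ᶠ k in atTop, ∀ m ∈ Finset.range n, |Mn k m| ≠ μ k := by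
    rw [Filter.eventually_all_finset]
    exact fun m hm => hfin m (Finset.mem_range.mp hm)
  obtain ⟨k, hk⟩ := hall.exists
  obtain ⟨m, hm, hmeq⟩ := hatt k
  exact hk m (Finset.mem_range.mpr hm) hmeq

end Summit.ValiantsHypothesis.ValiantsHypothesis.Theorems.LacunarySymmetroidMatrixDescartes.WallBubbling
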